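import Literature.NumberTheory.Sieve.LiouvillePolynomialValuesTypeIProofs
import Literature.NumberTheory.Sieve.AletheiaZomleferFukshanskyGarcia2020ApplicationsBrunSieveProofs
import Literature.NumberTheory.Sieve.IwaniecAlmostPrimesQuadraticRhoMeanValue
import Summits.Parity.BatemanHorn.Theorems.RoughValueTransportDefs
import HarnessLib

/-!
# Quadratic sieve for the balanced-semiprime layer, 1/7: definitions

The line `smooth-modulus-twisted-hooley` of crux `BalancedSemiprimeLayer` (route
`RoughValueTransport`, item stmt-Parity-9469) bounds the relaxed sifted divisor family
`pairFamily f i δ c x` of a QUADRATIC coordinate `g = fᵢ = aX² + bX + c` of a Bateman–Horn system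
`f` (window `m ∈ (x^{1−δ}, x^{1+δ}]`, `m ∣ g(n)`, `(m, B) = 1`, `B = |2a·disc g|`, every `fⱼ(n)`
free of primes `< x^c`) by ONE `(k+1)`-dimensional upper-bound sieve: the pairs `(n, m)` are
booked at the value `F(n) = ∏ⱼ fⱼ(n)` and sifted by the primes `< z = x^c` (the tree's PROVED
Fundamental Lemma `SieveSequence.fundamental_lemma_explicit`); the main term comes from the window
sums of `ρ_g(m)/m` (the tree's PROVED `RhoLogSums.abs_rhoLogSum_sub_le`), the remainders ARE the
uniform Type-I information `UniformTypeI g` on dyadic blocks of `n`.  The proof is spread over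
seven files `RoughValueTransportBalancedSemiprimeLayerQuadraticSieve<Part>.lean`, `<Part>` =
`Defs`, `Sequence`, `Remainder`, `Core`, `Bookkeeping`, `Height`, and the empty suffix (the
registered stub `stub_quadraticSieve`).

This file (kind `definition`): the bad number `B = |2aΔ|` and its radical `Q₀` with Hensel off
`Q₀` (`ρ_G(p^k) = ρ_G(p)`), the densities `g = rhoDensity a b c Q₀`,
`h_F = (ρ_F/·)·∏_{p∣·}(1 − g(p))` and the pair density `G = h_F ⋆ g` (multiplicative,
`1 − G(p) = (1 − g(p))(1 − ρ_F(p)/p)`, sieve dimension = dim `g` + dim `ρ_F/·`), the pair sequence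
`pairSeq` (weights `a_v = ∑_m #{n : m ∣ G(n), F(n) = v}`), the bookkeeping sets `modSet`,
`rootSet`, `blockCount`, `yTot`, and the constants `mertensA₁`, `winConst`, `mainConst`,
`lowConst` of the final bound.  Everything used is PROVED in the tree; nothing is asserted.
-/

noncomputable section

open Polynomial Filter Finset
open Literature.NumberTheory.Sieve
open scoped ArithmeticFunction.Moebius NumberTheorySymbols

namespace Summit.Parity.BatemanHorn.Cruxes.BalancedSemiprimeLayer.SmoothModulusTwistedHooley

namespace QuadraticSieve

open Iwaniec1978 RhoLogSums PropertySTypeI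

variable {a b c : ℤ}

/-! ### A. The bad number `B = |2aΔ|` and its radical `Q₀` -/

/-- `B_g = |2a·Δ|`, `Δ = b² − 4ac`: the bad number of `UniformTypeI` and `pairFamily`. [folklore] -/
def badB (a b c : ℤ) : ℕ := (2 * a * (b ^ 2 - 4 * a * c)).natAbs

/-- `Q₀ = rad B_g = ∏_{p ∣ 2aΔ} p`, the squarefree bad modulus fed to `RhoLogSums`. [folklore] -/
def badQ (a b c : ℤ) : ℕ := ∏ p ∈ (badB a b c).primeFactors, p

/-- `B_g ≠ 0` for an irreducible quadratic with `a > 0` (`Δ ≠ 0`). [folklore] -/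
theorem badB_ne_zero (ha : 0 < a) (hirr : Irreducible (quadPoly a b c)) : badB a b c ≠ 0 := by
  unfold badB
  rw [Ne, Int.natAbs_eq_zero, mul_eq_zero, mul_eq_zero, not_or, not_or]
  exact ⟨⟨two_ne_zero, ha.ne'⟩, disc_ne_zero ha.ne' hirr⟩

/-- `Q₀` is squarefree. [folklore] -/
theorem squarefree_badQ (a b c : ℤ) : Squarefree (badQ a b c) :=
  squarefree_prod_primes fun _ hp => Nat.prime_of_mem_primeFactors hp

/-- `Q₀ ≠ 0`. [folklore] -/
theorem badQ_ne_zero (a b c : ℤ) : badQ a b c ≠ 0 := (squarefree_badQ a b c).ne_zero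

/-- A prime divides `Q₀` iff it divides `B_g`. [folklore] -/
theorem prime_dvd_badQ_iff (hB : badB a b c ≠ 0) {p : ℕ} (hp : p.Prime) :
    p ∣ badQ a b c ↔ p ∣ badB a b c :=
  prime_dvd_rad_iff hB hp

/-- A prime dividing the integer `2aΔ` divides `Q₀`. [folklore] -/
theorem prime_dvd_badQ_of_dvd (hB : badB a b c ≠ 0) {p : ℕ} (hp : p.Prime)
    (h : (p : ℤ) ∣ 2 * a * (b ^ 2 - 4 * a * c)) : p ∣ badQ a b c := by
  rw [prime_dvd_badQ_iff hB hp, badB]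
  exact Int.natCast_dvd.mp h

/-- `2 ∣ Q₀`. [folklore] -/
theorem two_dvd_badQ (hB : badB a b c ≠ 0) : 2 ∣ badQ a b c :=
  prime_dvd_badQ_of_dvd hB Nat.prime_two ⟨a * (b ^ 2 - 4 * a * c), by push_cast; ring⟩

/-- The primes of `a` divide `Q₀`. [folklore] -/
theorem prime_dvd_badQ_of_dvd_a (hB : badB a b c ≠ 0) {p : ℕ} (hp : p.Prime) (h : (p : ℤ) ∣ a) :
    p ∣ badQ a b c :=
  prime_dvd_badQ_of_dvd hB hp ((h.mul_left 2).mul_right _)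

/-- The primes of `Δ` divide `Q₀`. [folklore] -/
theorem prime_dvd_badQ_of_dvd_disc (hB : badB a b c ≠ 0) {p : ℕ} (hp : p.Prime)
    (h : (p : ℤ) ∣ b ^ 2 - 4 * a * c) : p ∣ badQ a b c :=
  prime_dvd_badQ_of_dvd hB hp (h.mul_left _)

/-- `(m, B_g) = 1 ↔ (m, Q₀) = 1`. [folklore] -/
theorem coprime_badB_iff (hB : badB a b c ≠ 0) (m : ℕ) :
    m.Coprime (badB a b c) ↔ m.Coprime (badQ a b c) := by
  constructor
  · intro h
    refine Nat.coprime_of_dvd fun p hp hpm hpQ => ?_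
    have hpB : p ∣ badB a b c := (prime_dvd_badQ_iff hB hp).mp hpQ
    exact hp.one_lt.ne' ((h.coprime_dvd_left hpm).eq_one_of_dvd hpB)
  · intro h
    refine Nat.coprime_of_dvd fun p hp hpm hpB => ?_
    have hpQ : p ∣ badQ a b c := (prime_dvd_badQ_iff hB hp).mpr hpB
    exact hp.one_lt.ne' ((h.coprime_dvd_left hpm).eq_one_of_dvd hpQ)

/-- **Hensel off `Q₀`**: `ρ_G(p^k) = ρ_G(p)` for every prime `p ∤ Q₀` and `k ≥ 1` (the roots of
`G` modulo `p ∤ Δ` are simple; Hardy–Wright Thm 123, the tree's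
`Iwaniec1978.rhoG_primePow_eq_of_not_dvd_disc`). [folklore] -/
theorem rhoG_pow_eq_of_not_dvd_badQ (hB : badB a b c ≠ 0) {p : ℕ} (hp : p.Prime)
    (hpQ : ¬ p ∣ badQ a b c) {k : ℕ} (hk : 1 ≤ k) : rhoG a b c (p ^ k) = rhoG a b c p :=
  rhoG_primePow_eq_of_not_dvd_disc hp (fun h => hpQ (prime_dvd_badQ_of_dvd_disc hB hp h)) hk

/-- `ρ_G(p) ≤ 2` at the primes `p ∤ Q₀` (they do not divide the leading coefficient `a`;
Lagrange). [folklore] -/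
theorem rhoG_le_two_of_not_dvd_badQ (ha : 0 < a) (hB : badB a b c ≠ 0) {p : ℕ} (hp : p.Prime)
    (hpQ : ¬ p ∣ badQ a b c) : rhoG a b c p ≤ 2 := by
  have hpa : ¬ (p : ℤ) ∣ a := fun h => hpQ (prime_dvd_badQ_of_dvd_a hB hp h)
  have hlc : ¬ (p : ℤ) ∣ (quadPoly a b c).leadingCoeff := by rwa [leadingCoeff_quadPoly ha.ne']
  have h := polyRootCountMod_single_le_natDegree hp hlc
  rw [natDegree_quadPoly ha.ne'] at h
  exact h

/-! ### B. The densities: `g = rhoDensity`, `h_F = (ρ_F/·)·∏_{p∣·}(1 − g(p))`, `G = h_F ⋆ g` -/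

/-- The cofactor density `h_F(q) = (ρ_F(q)/q) · ∏_{p ∣ q} (1 − g(p))` (`g = rhoDensity a b c Q₀`),
a pointwise product of two multiplicative functions. [folklore] -/
def cofDensity (a b c : ℤ) (F : ℤ[X]) : ArithmeticFunction ℝ :=
  (rootDensity F).pmul
    (ArithmeticFunction.prodPrimeFactors fun p => 1 - rhoDensity a b c (badQ a b c) p)

/-- The density of the pair sequence: the Dirichlet convolution `G = h_F ⋆ g`. [folklore] -/
def pairDensity (a b c : ℤ) (F : ℤ[X]) : ArithmeticFunction ℝ :=
  cofDensity a b c F * rhoDensity a b c (badQ a b c)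

/-- `h_F` is multiplicative. [folklore] -/
theorem isMultiplicative_cofDensity (a b c : ℤ) (F : ℤ[X]) :
    (cofDensity a b c F).IsMultiplicative :=
  (isMultiplicative_rootDensity F).pmul (ArithmeticFunction.IsMultiplicative.prodPrimeFactors _)

/-- `G` is multiplicative. [folklore] -/
theorem isMultiplicative_pairDensity (a b c : ℤ) (F : ℤ[X]) :
    (pairDensity a b c F).IsMultiplicative :=
  (isMultiplicative_cofDensity a b c F).mul (isMultiplicative_rhoDensity a b c _)

/-- `h_F(q) = (ρ_F(q)/q) ∏_{p ∣ q} (1 − g(p))` for `q ≠ 0`. [folklore] -/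
theorem cofDensity_apply {F : ℤ[X]} {q : ℕ} (hq : q ≠ 0) :
    cofDensity a b c F q = (polyRootCountMod ![F] q : ℝ) / q *
      ∏ p ∈ q.primeFactors, (1 - rhoDensity a b c (badQ a b c) p) := by
  rw [cofDensity, ArithmeticFunction.pmul_apply, rootDensity_apply,
    ArithmeticFunction.prodPrimeFactors_apply hq]

/-- `G(d) = ∑_{e ∣ d} h_F(d/e) g(e)`. [folklore] -/
theorem pairDensity_apply (F : ℤ[X]) (d : ℕ) :
    pairDensity a b c F d =
      ∑ e ∈ d.divisors, cofDensity a b c F (d / e) * rhoDensity a b c (badQ a b c) e := by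
  rw [pairDensity, ArithmeticFunction.mul_apply]
  exact Nat.sum_divisorsAntidiagonal' (fun x y => cofDensity a b c F x * rhoDensity a b c _ y)

/-- `G(p) = g(p) + (ρ_F(p)/p)(1 − g(p))` at a prime. [folklore] -/
theorem pairDensity_prime (F : ℤ[X]) {p : ℕ} (hp : p.Prime) :
    pairDensity a b c F p = rhoDensity a b c (badQ a b c) p +
      (polyRootCountMod ![F] p : ℝ) / p * (1 - rhoDensity a b c (badQ a b c) p) := by
  rw [pairDensity_apply, hp.divisors, Finset.sum_pair hp.one_lt.ne, Nat.div_one,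
    Nat.div_self hp.pos, cofDensity_apply hp.ne_zero, hp.primeFactors, Finset.prod_singleton,
    (isMultiplicative_cofDensity a b c F).map_one, (isMultiplicative_rhoDensity a b c _).map_one]
  ring

/-- `1 − G(p) = (1 − g(p))(1 − ρ_F(p)/p)` at a prime. [folklore] -/
theorem one_sub_pairDensity_prime (F : ℤ[X]) {p : ℕ} (hp : p.Prime) :
    1 - pairDensity a b c F p =
      (1 - rhoDensity a b c (badQ a b c) p) * (1 - (polyRootCountMod ![F] p : ℝ) / p) := by
  rw [pairDensity_prime F hp]
  ring

/-- **Sieve dimension of `G`**: if `g` has dimension `1` with constant `K₁` and `ρ_F/·` has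
dimension `κ₂` with constant `K₂`, then `G` has dimension `κ₂ + 1` with constant `K₁K₂`
(`(1 − G(p))⁻¹ = (1 − g(p))⁻¹ (1 − ρ_F(p)/p)⁻¹`). [folklore] -/
theorem hasSieveDimension_pairDensity {F : ℤ[X]} {K₁ κ₂ K₂ : ℝ}
    (hdimg : HasSieveDimension (rhoDensity a b c (badQ a b c)) 1 K₁)
    (hdimF : HasSieveDimension (rootDensity F) κ₂ K₂) :
    HasSieveDimension (pairDensity a b c F) (κ₂ + 1) (K₁ * K₂) := by
  have hK₁ : 1 ≤ K₁ := hdimg.one_le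
  have hK₂ : 1 ≤ K₂ := hdimF.one_le
  refine ⟨fun p hp => ?_, fun w z hw hwz => ?_⟩
  · have hg := hdimg.1 p hp
    have hr := hdimF.1 p hp
    rw [rootDensity_apply] at hr
    refine ⟨?_, ?_⟩
    · rw [pairDensity_prime F hp]
      have : 0 ≤ (polyRootCountMod ![F] p : ℝ) / p * (1 - rhoDensity a b c (badQ a b c) p) :=
        mul_nonneg hr.1 (by linarith [hg.2])
      linarith [hg.1]
    · have h1 : 0 < 1 - pairDensity a b c F p := by
        rw [one_sub_pairDensity_prime F hp]
        exact mul_pos (by linarith [hg.2]) (by linarith [hr.2])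
      linarith
  · set S := (Nat.primesBelow ⌈z⌉₊).filter (fun p : ℕ => w ≤ (p : ℝ)) with hS
    have hprime : ∀ p ∈ S, p.Prime := fun p hp =>
      (Nat.mem_primesBelow.mp (Finset.mem_filter.mp hp).1).2
    have hsplit : ∏ p ∈ S, (1 - pairDensity a b c F p)⁻¹ =
        (∏ p ∈ S, (1 - rhoDensity a b c (badQ a b c) p)⁻¹) *
          ∏ p ∈ S, (1 - rootDensity F p)⁻¹ := by
      rw [← Finset.prod_mul_distrib]
      refine Finset.prod_congr rfl fun p hp => ?_
      rw [one_sub_pairDensity_prime F (hprime p hp), mul_inv, rootDensity_apply]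
    rw [hsplit]
    have h1 := hdimg.2 w z hw hwz
    have h2 := hdimF.2 w z hw hwz
    rw [Real.rpow_one] at h1
    have hlogw : 0 < Real.log w := Real.log_pos (by linarith)
    have hL : 1 ≤ Real.log z / Real.log w := by
      rw [le_div_iff₀ hlogw, one_mul]; exact Real.log_le_log (by linarith) hwz
    have hL0 : 0 < Real.log z / Real.log w := by linarith
    have hnn1 : 0 ≤ ∏ p ∈ S, (1 - rhoDensity a b c (badQ a b c) p)⁻¹ :=
      Finset.prod_nonneg fun p hp => inv_nonneg.mpr (by linarith [(hdimg.1 p (hprime p hp)).2])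
    have hnn2 : 0 ≤ ∏ p ∈ S, (1 - rootDensity F p)⁻¹ :=
      Finset.prod_nonneg fun p hp => inv_nonneg.mpr (by linarith [(hdimF.1 p (hprime p hp)).2])
    calc (∏ p ∈ S, (1 - rhoDensity a b c (badQ a b c) p)⁻¹) * ∏ p ∈ S, (1 - rootDensity F p)⁻¹
        ≤ (K₁ * (Real.log z / Real.log w)) * (K₂ * (Real.log z / Real.log w) ^ κ₂) :=
          mul_le_mul h1 h2 hnn2 (by positivity)
      _ = K₁ * K₂ * ((Real.log z / Real.log w) ^ κ₂ * (Real.log z / Real.log w) ^ (1 : ℝ)) := by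
          rw [Real.rpow_one]; ring
      _ = K₁ * K₂ * (Real.log z / Real.log w) ^ (κ₂ + 1) := by
          rw [← Real.rpow_add hL0]

/-! ### The pair sequence -/

/-- **The pair sequence.**  Weights on the values: `a_v = ∑_{m ∈ M} #{n ∈ R : m ∣ G(n), F(n) = v}`
(the pairs `(n, m)` with `m ∣ G(n)`, booked at the value `F(n)`), expected size `X`, density `g`.
[folklore] -/
def pairSeq (G F : ℤ[X]) (R M : Finset ℕ) (X : ℝ) (g : ArithmeticFunction ℝ)
    (hg : g.IsMultiplicative) : SieveSequence where
  a v := ∑ m ∈ M, (#(R.filter fun n : ℕ => (m : ℤ) ∣ G.eval (n : ℤ) ∧ F.eval (n : ℤ) = (v : ℤ)) : ℝ)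
  a_nonneg _ := Finset.sum_nonneg fun _ _ => Nat.cast_nonneg _
  size _ := X
  density := g
  density_mult := hg

/-! ### Bookkeeping sets: moduli, root classes, block counts, block lengths -/

/-- The moduli of the window `(U, V]` with level `e` and prime to `q·B`. [folklore] -/
def modSet (U V e q B : ℕ) : Finset ℕ :=
  (Ioc U V).filter (fun m : ℕ => e ∣ m ∧ m.Coprime (q * B))

/-- The root classes of `F` modulo `q`. [folklore] -/
def rootSet (F : ℤ[X]) (q : ℕ) : Finset ℕ :=
  (range q).filter (fun r : ℕ => (q : ℤ) ∣ F.eval (r : ℤ))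

/-- The block count `#{2^jY < t ≤ 2^{j+1}Y : t ≡ r (q), m ∣ G(t)}` (the quantity controlled by
`UniformTypeI`). [folklore] -/
def blockCount (G : ℤ[X]) (Y j q r m : ℕ) : ℕ :=
  #((Ioc (2 ^ j * Y) (2 * (2 ^ j * Y))).filter
    (fun t : ℕ => t % q = r % q ∧ (m : ℤ) ∣ G.eval (t : ℤ)))

/-- `∑_{j<J} 2^j Y`, the total length of the dyadic blocks (a real number). [folklore] -/
def yTot (Y J : ℕ) : ℝ := ∑ j ∈ range J, ((2 ^ j * Y : ℕ) : ℝ)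

/-- `0 ≤ yTot`. [folklore] -/
theorem yTot_nonneg (Y J : ℕ) : 0 ≤ yTot Y J := Finset.sum_nonneg fun _ _ => Nat.cast_nonneg _

/-! ### The constants of the final bound -/

/-- Mertens' constant `A₁ = e^{6/log 2} log 2` of `Lichtman2020.prod_primesLE_one_sub_inv_le`
(`∏_{p ≤ y}(1 − 1/p) ≤ A₁/log y`). [folklore] -/
def mertensA₁ : ℝ := Real.exp (6 / Real.log 2) * Real.log 2

/-- `0 < A₁`. [folklore] -/
theorem mertensA₁_pos : 0 < mertensA₁ := mul_pos (Real.exp_pos _) (Real.log_pos one_lt_two)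

/-- The `V`-free part of the window constant: `K_V = kWin χ Q V ≤ winConst χ Q · (1 + log V)`.
[folklore] -/
def winConst {N : ℕ} [NeZero N] (χ : DirichletCharacter ℂ N) (Q : ℕ) : ℝ :=
  5 * (N : ℝ) * (#Q.divisors : ℝ) ^ 3 +
    8 * |(χ.LFunction 1).re * ∑ f ∈ Q.divisors, (μ f : ℝ) *
      Literature.NumberTheory.LFunctions.RealChar.charDivisorDensity χ f|

/-- `0 ≤ winConst`. [folklore] -/
theorem winConst_nonneg {N : ℕ} [NeZero N] (χ : DirichletCharacter ℂ N) (Q : ℕ) :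
    0 ≤ winConst χ Q := by
  unfold winConst
  exact add_nonneg (mul_nonneg (mul_nonneg (by norm_num) (Nat.cast_nonneg _))
    (pow_nonneg (Nat.cast_nonneg _) 3)) (mul_nonneg (by norm_num) (abs_nonneg _))

/-- `kWin χ Q V ≤ winConst χ Q · (1 + log V)` for `V ≥ 1`. [folklore] -/
theorem kWin_le_winConst {N : ℕ} [NeZero N] (χ : DirichletCharacter ℂ N) (Q : ℕ) {V : ℕ}
    (hV : 1 ≤ V) : kWin χ Q V ≤ winConst χ Q * (1 + Real.log V) := by
  have hlogV0 : 0 ≤ Real.log V := Real.log_nonneg (by exact_mod_cast hV)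
  have habs0 : 0 ≤ 8 * |(χ.LFunction 1).re * ∑ f ∈ Q.divisors, (μ f : ℝ) *
      Literature.NumberTheory.LFunctions.RealChar.charDivisorDensity χ f| := by positivity
  have := le_mul_of_one_le_right habs0 (show (1 : ℝ) ≤ 1 + Real.log V by linarith)
  unfold kWin winConst
  linarith

/-- **The constant of the main term**: `K = (1 + C_FL)·𝔠·2·(Q₀ e⁶ · 2C_g · 2C_f · (2A₁)^{k+1})`.
[folklore] -/
def mainConst {N : ℕ} [NeZero N] (χ : DirichletCharacter ℂ N) (Q : ℕ) (CFL Cg Cf : ℝ)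
    (k : ℕ) : ℝ :=
  (1 + CFL) * cMain χ Q * 2 *
    ((Q : ℝ) * Real.exp 6 * (2 * Cg) * (2 * Cf) * (2 * mertensA₁) ^ (k + 1))

/-- **The constant of the lower-order terms**:
`C_low = 3·max(K_T, 0) + 8𝔠 + 24√2·winConst + 2^{⌈2/c⌉+1}`. [folklore] -/
def lowConst {N : ℕ} [NeZero N] (χ : DirichletCharacter ℂ N) (Q : ℕ) (KT cc : ℝ) : ℝ :=
  3 * max KT 0 + 8 * cMain χ Q + 24 * Real.sqrt 2 * winConst χ Q + 2 ^ (⌈2 / cc⌉₊ + 1)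

end QuadraticSieve

/-- **Anchor of part 1/7**: the registered sub-goal `stub_quadraticSieve_part1` of
`stub_quadraticSieve` (`ledger workitem stub-add`), through which this helper file lands
`--supports stmt-Parity-9469`:
the density identity `1 − G(p) = (1 − g(p))(1 − ρ_F(p)/p)` of the pair density. [folklore] -/
theorem stub_quadraticSieve_part1 :
    ∀ (a b c : ℤ) (F : ℤ[X]) (p : ℕ), p.Prime → 1 - QuadraticSieve.pairDensity a b c F p = (1 -
      RhoLogSums.rhoDensity a b c (QuadraticSieve.badQ a b c) p) * (1 - (polyRootCountMod ![F] p :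
      ℝ) / p) :=
  fun _ _ _ F _ hp => QuadraticSieve.one_sub_pairDensity_prime F hp

end Summit.Parity.BatemanHorn.Cruxes.BalancedSemiprimeLayer.SmoothModulusTwistedHooley
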